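import Mathlib
import Literature.Geometry.DiscreteGeometry.TwoShellPatterns
import Literature.MathematicalPhysics.StatisticalMechanics.Crystallization
import Summits.AtomisticToContinuum.Crystallization.Theorems.PhononStability.Negative.Mirror

/-!
# Crux `NashNearField` (stmt-AtomisticToContinuum-16827), line `birth`: pieces around the stub `stub_tubeCoercivity` (TC)

TC (registered, force-balance-free, = ideator-2 `TubeCoercivity` with `hessPair` inlined) asks for `κ > 0` with
`κ · Σ_i Σ_{j ≠ i} [|x_i − x_j| ≤ 11/10] ‖u_i − u_j‖² ≤ ½ Σ_i Σ_{j ≠ i} Hess₀ (x_i − x_j) (u_i − u_j)` for every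
`1/3`-separated `x`, every region `Ω'` whose radius-4 neighbourhood is 1/20-good and every `u` supported in `Ω'`
(`Hess₀ e w = V″(|e|)(ê·w)² + (V′(|e|)/|e|)(|w|² − (ê·w)²)`, `V` = `lennardJones`).  This file lands the provable
interface of the only known proof architecture — a SITE-WISE CERTIFICATE — and records why its naive form is empty.

* `tc_sum_weighted_pairs` — partition-of-unity bookkeeping over ordered pairs: if the weights `ω c i j` of every
  ordered pair `(i, j)`, `i ≠ j`, over the centres `c` sum to `1`, then `Σ_c Σ_i Σ_{j≠i} ω c i j · F i j = Σ_i Σ_{j≠i} F i j`.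
* `tc_coercivity_of_siteCertificates` — abstract site-wise certificate ⇒ global inequality: per-centre forms
  `Q_c = ½ Σ ω c i j · H i j` (weighted pair Hessian), `M_c = Σ ω' c i j · S i j` (weighted strain) and a slack `Z_c`
  with `Σ_c Z_c = 0` (a discrete null Lagrangian: any antisymmetrised two-point form, e.g. the second variation of the
  signed volume of a tetrahedral tiling, which vanishes in total for displacements supported inside) satisfying
  `κ M_c ≤ Q_c + Z_c` for every `c` give `κ Σ S ≤ ½ Σ H`.
* `stub_tubeCoercivityOfSiteCertificates` — the same, instantiated verbatim on the registered signature of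
  `stub_tubeCoercivity`: a site-wise certificate for every tube datum `(x, Ω', u)` implies TC.
* `hess₀_of_orthogonal`, `hess₀_neg_of_compressed` — why the slack `Z` (or clusters reaching beyond the star) is
  NECESSARY: on a displacement difference `w ⊥ e` the pair form is the pure pre-stress `(V′(|e|)/|e|)‖w‖²`, which is
  `< 0` for every compressed bond `0 < |e| < 1`; since the differences `u_i − u_j` over the star of `i` are independent
  variables, the half-bond star form of a site with one compressed bond (every site of the tube below scale `1`, and of
  the Lennard-Jones ground state itself, nearest-neighbour distance `≈ 0.9713`) is indefinite — no `κ ≥ 0` works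
  star-wise without transfers.  (Numerics, this line: free-boundary cluster forms of radius `2` are negative exactly on
  rigid rotations at scale `0.9713`, quotient `−0.104`; the volume null Lagrangian with coefficient `c ∈ [1/2, 5/2]`
  restores positivity at scales `0.9713 … 1.0354` but not at `0.95` and below; homogeneous-tube infimum of the TC
  quotient `≈ 0.079`, attained at scale `a = 1`, principal strains `(−4.1 %, −0.3 %, +4.5 %)`, on the long `⟨110⟩/⟨1̄10⟩`
  shear wave — kit jobs j026784/j026785 attached to the item.)

All `[folklore]`; `--supports` pieces, nothing here closes an item.
-/

noncomputable section

namespace Summit.AtomisticToContinuum.Crystallization.Theorems.NashClassCertificatesNashNearField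

open scoped BigOperators RealInnerProductSpace
open Literature.MathematicalPhysics.StatisticalMechanics Literature.Geometry.DiscreteGeometry
open Summit.AtomisticToContinuum.Crystallization.Theorems.PhononStabilityNegative
  (Hess₀ deriv_lennardJones Hess₀_of_inner_eq_zero)

/-! ## Partition-of-unity bookkeeping over ordered pairs -/

/-- **Weighted re-summation over centres.**  If for every ordered pair `(i, j)`, `i ≠ j`, the weights over the
centres sum to one, `Σ_c ω c i j = 1`, then `Σ_c Σ_i Σ_{j ≠ i} ω c i j · F i j = Σ_i Σ_{j ≠ i} F i j`. [folklore] -/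
theorem tc_sum_weighted_pairs {ι : Type*} [Fintype ι] [DecidableEq ι] (ω : ι → ι → ι → ℝ) (F : ι → ι → ℝ)
    (hω : ∀ i j, i ≠ j → ∑ c, ω c i j = 1) :
    ∑ c, ∑ i, ∑ j ∈ Finset.univ.erase i, ω c i j * F i j = ∑ i, ∑ j ∈ Finset.univ.erase i, F i j := by
  rw [Finset.sum_comm]
  refine Finset.sum_congr rfl fun i _ => ?_
  rw [Finset.sum_comm]
  refine Finset.sum_congr rfl fun j hj => ?_
  rw [← Finset.sum_mul, hω i j (Finset.ne_of_mem_erase hj).symm, one_mul]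

/-- **Site-wise certificate ⇒ global coercivity (abstract form).**  Per-centre weighted pair forms
`Q_c = ½ Σ_i Σ_{j≠i} ω c i j · H i j`, weighted strains `M_c = Σ_i Σ_{j≠i} ω' c i j · S i j` (both weight families
partitions of unity over the centres) and slacks `Z_c` summing to zero with `κ M_c ≤ Q_c + Z_c` for every centre give
`κ Σ_i Σ_{j≠i} S i j ≤ ½ Σ_i Σ_{j≠i} H i j`. [folklore] -/
theorem tc_coercivity_of_siteCertificates {ι : Type*} [Fintype ι] [DecidableEq ι] {κ : ℝ}
    (S H : ι → ι → ℝ) (ω ω' : ι → ι → ι → ℝ) (Z : ι → ℝ)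
    (hω : ∀ i j, i ≠ j → ∑ c, ω c i j = 1) (hω' : ∀ i j, i ≠ j → ∑ c, ω' c i j = 1) (hZ : ∑ c, Z c = 0)
    (hloc : ∀ c, κ * ∑ i, ∑ j ∈ Finset.univ.erase i, ω' c i j * S i j ≤
      (1 / 2 : ℝ) * (∑ i, ∑ j ∈ Finset.univ.erase i, ω c i j * H i j) + Z c) :
    κ * ∑ i, ∑ j ∈ Finset.univ.erase i, S i j ≤ (1 / 2 : ℝ) * ∑ i, ∑ j ∈ Finset.univ.erase i, H i j := by
  have h := Finset.sum_le_sum fun c (_ : c ∈ (Finset.univ : Finset ι)) => hloc c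
  rw [← Finset.mul_sum, Finset.sum_add_distrib, ← Finset.mul_sum, hZ, add_zero,
    tc_sum_weighted_pairs ω' S hω', tc_sum_weighted_pairs ω H hω] at h
  exact h

/-! ## The site-wise certificate form of `stub_tubeCoercivity` -/

/-- **TC from site-wise certificates** (instantiation of `tc_coercivity_of_siteCertificates` on the registered
signature of `stub_tubeCoercivity`): if one `κ > 0` admits, for every tube datum — a `1/3`-separated configuration
`x`, a region `Ω'` with 1/20-good radius-4 neighbourhood, a displacement `u` supported in `Ω'` — weight families
`ω, ω'` (partitions of unity of the ordered pairs over the centres) and slacks `Z` with `Σ_c Z c = 0` such that every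
centre's weighted strain is dominated, `κ M_c ≤ Q_c + Z_c`, then the conclusion of `stub_tubeCoercivity` holds with
that `κ`.  The content of TC is thus the existence of TRANSFERABLE local certificates (weights depending on the local
geometry only, slack a discrete null Lagrangian); see the module doc-string for why `Z = 0` with half-bond stars is
impossible. [folklore] -/
theorem stub_tubeCoercivityOfSiteCertificates :
    (∃ κ : ℝ, 0 < κ ∧ ∀ (N : ℕ) (x : Fin N → EuclideanSpace ℝ (Fin 3)), (∀ i j : Fin N, i ≠ j → 1 / 3 ≤ dist (x i) (x
      j)) → ∀ Ω' : Finset (Fin N), (∀ i ∈ Ω', ∀ j : Fin N, dist (x j) (x i) ≤ 4 → IsTwoShellGood (1 / 20) (47 / 50) 1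
      x j) → ∀ u : Fin N → EuclideanSpace ℝ (Fin 3), (∀ i, i ∉ Ω' → u i = 0) → ∃ (ω ω' : Fin N → Fin N → Fin N → ℝ)
      (Z : Fin N → ℝ), (∀ i j, i ≠ j → ∑ c, ω c i j = 1) ∧ (∀ i j, i ≠ j → ∑ c, ω' c i j = 1) ∧ ∑ c, Z c = 0 ∧ ∀ c :
      Fin N, κ * ∑ i, ∑ j ∈ Finset.univ.erase i, ω' c i j * (if dist (x i) (x j) ≤ 11 / 10 then ‖u i - u j‖ ^ 2 else
      0) ≤ (1 / 2 : ℝ) * (∑ i, ∑ j ∈ Finset.univ.erase i, ω c i j * (fun (e w : EuclideanSpace ℝ (Fin 3)) => deriv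
      (deriv lennardJones) ‖e‖ * (inner ℝ e w / ‖e‖) ^ 2 + deriv lennardJones ‖e‖ / ‖e‖ * (‖w‖ ^ 2 - (inner ℝ e w /
      ‖e‖) ^ 2)) (x i - x j) (u i - u j)) + Z c) → ∃ κ : ℝ, 0 < κ ∧ ∀ (N : ℕ) (x : Fin N → EuclideanSpace ℝ (Fin 3)),
      (∀ i j : Fin N, i ≠ j → 1 / 3 ≤ dist (x i) (x j)) → ∀ Ω' : Finset (Fin N), (∀ i ∈ Ω', ∀ j : Fin N, dist (x j)
      (x i) ≤ 4 → IsTwoShellGood (1 / 20) (47 / 50) 1 x j) → ∀ u : Fin N → EuclideanSpace ℝ (Fin 3), (∀ i, i ∉ Ω' → u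
      i = 0) → κ * (∑ i, ∑ j ∈ Finset.univ.erase i, (if dist (x i) (x j) ≤ 11 / 10 then ‖u i - u j‖ ^ 2 else 0)) ≤ (1
      / 2 : ℝ) * ∑ i, ∑ j ∈ Finset.univ.erase i, (fun (e w : EuclideanSpace ℝ (Fin 3)) => deriv (deriv lennardJones)
      ‖e‖ * (inner ℝ e w / ‖e‖) ^ 2 + deriv lennardJones ‖e‖ / ‖e‖ * (‖w‖ ^ 2 - (inner ℝ e w / ‖e‖) ^ 2)) (x i - x j)
      (u i - u j) := by
  rintro ⟨κ, hκ, h⟩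
  refine ⟨κ, hκ, fun N x hsep Ω' hgood u hu => ?_⟩
  obtain ⟨ω, ω', Z, hω, hω', hZ, hloc⟩ := h N x hsep Ω' hgood u hu
  exact tc_coercivity_of_siteCertificates
    (fun i j => if dist (x i) (x j) ≤ 11 / 10 then ‖u i - u j‖ ^ 2 else 0)
    (fun i j => (fun (e w : EuclideanSpace ℝ (Fin 3)) => deriv (deriv lennardJones) ‖e‖ * (inner ℝ e w / ‖e‖) ^ 2 +
      deriv lennardJones ‖e‖ / ‖e‖ * (‖w‖ ^ 2 - (inner ℝ e w / ‖e‖) ^ 2)) (x i - x j) (u i - u j))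
    ω ω' Z hω hω' hZ hloc

/-! ## Why the slack is necessary: the pre-stress of a compressed bond -/

/-- The inlined pair form of the stub is the mirror's `Hess₀`. [folklore] -/
theorem tc_pairForm_eq_Hess₀ (e w : EuclideanSpace ℝ (Fin 3)) :
    (fun (e w : EuclideanSpace ℝ (Fin 3)) => deriv (deriv lennardJones) ‖e‖ * (inner ℝ e w / ‖e‖) ^ 2 +
      deriv lennardJones ‖e‖ / ‖e‖ * (‖w‖ ^ 2 - (inner ℝ e w / ‖e‖) ^ 2)) e w = Hess₀ e w :=
  rfl

/-- **Transverse pair stiffness = pre-stress.**  For `w ⊥ e`, `e ≠ 0`: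
`Hess₀ e w = (V′(|e|)/|e|)‖w‖² = (−|e|⁻¹⁴ + |e|⁻⁸)‖w‖²`. [folklore] -/
theorem hess₀_of_orthogonal {e w : EuclideanSpace ℝ (Fin 3)} (he : e ≠ 0) (h : inner ℝ e w = 0) :
    Hess₀ e w = (-(‖e‖⁻¹) ^ 14 + (‖e‖⁻¹) ^ 8) * ‖w‖ ^ 2 := by
  have hn : ‖e‖ ≠ 0 := norm_ne_zero_iff.2 he
  rw [Hess₀_of_inner_eq_zero h, deriv_lennardJones hn, div_eq_mul_inv]
  ring

/-- **A compressed bond is transversally unstable**: for `0 < |e| < 1` and `w ⊥ e`, `w ≠ 0`, the pair form is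
negative, `Hess₀ e w < 0`.  Hence the half-bond star form `½ Σ_{j ∈ star(i)} Hess₀ (x_i − x_j) (u_i − u_j)`, whose
arguments `u_i − u_j` are independent variables, is indefinite at every site with a compressed bond: a site-wise
certificate for TC needs transfers (`Z ≠ 0`) or weights reaching beyond the star. [folklore] -/
theorem hess₀_neg_of_compressed {e w : EuclideanSpace ℝ (Fin 3)} (he : e ≠ 0) (he1 : ‖e‖ < 1)
    (h : inner ℝ e w = 0) (hw : w ≠ 0) : Hess₀ e w < 0 := by
  rw [hess₀_of_orthogonal he h]
  have hpos : 0 < ‖e‖ := norm_pos_iff.2 he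
  have hw2 : 0 < ‖w‖ ^ 2 := by positivity
  have hx1 : 1 < ‖e‖⁻¹ := one_lt_inv_iff₀.2 ⟨hpos, he1⟩
  have hx0 : 0 < ‖e‖⁻¹ := by positivity
  have h6 : 1 < (‖e‖⁻¹) ^ 6 := one_lt_pow₀ hx1 (by norm_num)
  have h8 : 0 < (‖e‖⁻¹) ^ 8 := by positivity
  have hneg : -(‖e‖⁻¹) ^ 14 + (‖e‖⁻¹) ^ 8 < 0 := by
    have : (‖e‖⁻¹) ^ 14 = (‖e‖⁻¹) ^ 8 * (‖e‖⁻¹) ^ 6 := by ring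
    rw [this]
    nlinarith
  exact mul_neg_of_neg_of_pos hneg hw2

end Summit.AtomisticToContinuum.Crystallization.Theorems.NashClassCertificatesNashNearField

end
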